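import Summits.NavierStokesRegularity.NavierStokesRegularity.Theorems.CircuitTrace.Negative.LoadBearing

/-!
# `PerpetualPump.CircuitTrace` (crux stmt-NavierStokesRegularity-1836): the structure every
# counterexample must beat — negative-side support, II (cdisprove seat)

Sorry-free structural lemmas on Tao's viscous circuit class (`circuitRHS` of companion I,
`Negative/LoadBearing.lean`), used by the standing disprover's proof architecture recorded in
`Cruxes/CircuitTrace/Disproof.lean`:

* §3a one-sided coupling (`circuitRHS_eq_zero_of_vanishing_below`): every monomial driving scale
  `n` has a factor at a scale `≤ n`, so `{X_{≤N} = 0}` is invariant;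
* §3b energy conservation of the nonlinearity from the cyclic condition (`trilinear_cancel`,
  orbit argument over `S₃` acting on (index-triple, offset));
* §3c the size of the vector field on the low block (`circuitRHS_abs_le`) and BACKWARD GRÖNWALL /
  backward uniqueness for the low block (`block_backward_gronwall`, `block_eq_zero_backward`) — the
  formal kernel of the planner's flagged gap "backward uniqueness of the chain at blow-up": a front
  cannot pass tracelessly.

No statement here asserts a `Theses` decl positively. [folklore]
-/

noncomputable section

set_option linter.dupNamespace false

namespace Summit.NavierStokesRegularity.NavierStokesRegularity.Theorems.CircuitTrace.Negative

open Finset Real Set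

/-! ## §3a One-sided coupling -/

/-- ONE-SIDED COUPLING (support invariance). Every interaction driving scale `n` contains a factor
at a scale `≤ n` (offsets `(0,0,0)`: `X_n X_n`; `(1,0,0)`,`(0,1,0)`: `X_{n+1} X_n`; `(0,0,1)`:
`X_{n-1} X_{n-1}`). Hence if all modes at scales `≤ n` vanish at time `t`, then `F_{i,n'}(t) = 0`
for every `n' ≤ n`: the subspace `{X_{≤ n} = 0}` is invariant under the flow, in both time
directions wherever uniqueness holds (see `block_backward_gronwall`). A traceless transfer that
EMPTIES the scales `≤ n` at a finite time is therefore impossible — the exact obstruction the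
recentring argument for `CircuitTrace` exploits. -/
theorem circuitRHS_eq_zero_of_vanishing_below (lam : ℝ) {m : ℕ}
    (coeff : Fin m → Fin m → Fin m → Option (Fin 3) → ℝ) (X : Fin m → ℤ → ℝ → ℝ) (i : Fin m)
    (n : ℤ) (t : ℝ) (h : ∀ (i' : Fin m) (n' : ℤ), n' ≤ n → X i' n' t = 0) :
    circuitRHS lam coeff X i n t = 0 := by
  unfold circuitRHS
  rw [h i n le_rfl, mul_zero, zero_add]
  refine Finset.sum_eq_zero fun i₁ _ => Finset.sum_eq_zero fun i₂ _ =>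
    Finset.sum_eq_zero fun μ _ => ?_
  rcases μ with _ | a
  · simp [h i₁ n le_rfl]
  · fin_cases a
    · simp [h i₂ n le_rfl]
    · simp [h i₁ n le_rfl]
    · have h' : X i₁ (n + -1) t = 0 := h i₁ _ (by linarith)
      simp [h']

/-! ## §3b Energy conservation of the nonlinearity -/

/-- ENERGY CONSERVATION OF THE NONLINEARITY — the algebraic core, in the `Option (Fin 3)`
encoding. For amplitudes `Y` (scale `n`) and `Z` (scale `n+1`) the trilinear expression collecting
ALL interactions with base scale `n`,
`Σ_{v : Fin 3 → Fin m} Σ_μ coeff(v₀,v₁,v₂,μ) · Π_a W^{(a)}_μ(v_a)`, `W^{(a)}_μ = Z` if `μ = some a`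
and `Y` otherwise, vanishes under (cyclic): the orbits of `S₃` acting by
`(v, μ) ↦ (v ∘ σ, σ⁻¹·μ)` have constant monomial, and (cyclic) says each orbit sum of `coeff` is
zero. Consequence (for sums that converge absolutely, e.g. under the a-priori `H¹⁰` bound or for
finitely supported states): `Σ_{i,n} X_{i,n}·(F_{i,n} + lam^{4n/5}X_{i,n}) = 0`, i.e.
`d/dt ½ΣX² = -Σ_n lam^{4n/5}|X_n|²`, and the energy flux from scales `≤ b` to scales `≥ b+1` is
the `μ = some 2` part at base `b` alone, `lam^b Σ coeff(i₁,i₂,i₃,some 2) X_{i₁,b}X_{i₂,b}X_{i₃,b+1}`,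
of size `≤ K lam^{2b/5} a_b² a_{b+1}` in critical units `a_n = lam^{n/5}|X_n|` — the FUNDING
bound of the disprover's proof architecture (`Cruxes/CircuitTrace/Disproof.lean`). -/
theorem trilinear_cancel {m : ℕ} {coeff : Fin m → Fin m → Fin m → Option (Fin 3) → ℝ}
    (hcyc : IsCyclic coeff) (Y Z : Fin m → ℝ) :
    ∑ v : Fin 3 → Fin m, ∑ μ : Option (Fin 3),
      coeff (v 0) (v 1) (v 2) μ * ∏ a : Fin 3, (if μ = some a then Z else Y) (v a) = 0 := by
  set P : (Fin 3 → Fin m) → Option (Fin 3) → ℝ :=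
    fun v μ => ∏ a : Fin 3, (if μ = some a then Z else Y) (v a) with hPdef
  have hP : ∀ (σ : Equiv.Perm (Fin 3)) (v : Fin 3 → Fin m) (μ : Option (Fin 3)),
      P (v ∘ σ) (Option.map σ.symm μ) = P v μ := by
    intro σ v μ
    simp only [hPdef, Function.comp_apply]
    rw [← Equiv.prod_comp σ (fun b => (if μ = some b then Z else Y) (v b))]
    refine Finset.prod_congr rfl fun a _ => ?_
    rcases μ with _ | b
    · simp
    · have : (Option.map (⇑σ.symm) (some b) = some a) = (some b = some (σ a)) := by
        rw [Option.map_some, Option.some.injEq, Option.some.injEq, eq_iff_iff]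
        exact Equiv.symm_apply_eq σ
      simp only [this]
  change ∑ v : Fin 3 → Fin m, ∑ μ : Option (Fin 3), coeff (v 0) (v 1) (v 2) μ * P v μ = 0
  set S := ∑ v : Fin 3 → Fin m, ∑ μ : Option (Fin 3), coeff (v 0) (v 1) (v 2) μ * P v μ with hS
  have hSσ : ∀ σ : Equiv.Perm (Fin 3),
      S = ∑ v : Fin 3 → Fin m, ∑ μ : Option (Fin 3),
        coeff (v (σ 0)) (v (σ 1)) (v (σ 2)) (Option.map σ.symm μ) * P v μ := by
    intro σ
    rw [hS, ← Equiv.sum_comp (σ.symm.arrowCongr (Equiv.refl (Fin m)))]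
    refine Finset.sum_congr rfl fun v _ => ?_
    rw [← Equiv.sum_comp (Equiv.optionCongr σ.symm)]
    refine Finset.sum_congr rfl fun μ _ => ?_
    have hv : (σ.symm.arrowCongr (Equiv.refl (Fin m))) v = v ∘ σ := rfl
    rw [hv, Equiv.optionCongr_apply, hP σ v μ]
    rfl
  have h6 : (6 : ℝ) * S = 0 := by
    have : ∑ _σ : Equiv.Perm (Fin 3), S = 6 * S := by
      rw [Finset.sum_const, Finset.card_univ, Fintype.card_perm, Fintype.card_fin, nsmul_eq_mul]
      norm_num [Nat.factorial]
    rw [← this, Finset.sum_congr rfl fun σ _ => hSσ σ, Finset.sum_comm]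
    refine Finset.sum_eq_zero fun v _ => ?_
    rw [Finset.sum_comm]
    refine Finset.sum_eq_zero fun μ _ => ?_
    rw [← Finset.sum_mul, hcyc v μ, zero_mul]
  linarith

/-! ## §3c Backward Grönwall on the low block -/

/-- Size of the circuit vector field on the block of scales `0 ≤ n ≤ N`: linear in the block
amplitude `W`, with a Lipschitz constant `lam^N (1 + 4 m² K B)` governed by the LOW rates
`lam^{4n/5} ≤ lam^N` and a bound `B` on the neighbouring amplitudes (scales `≤ N+1`). Every
quadratic monomial has one factor at a scale `≤ n ≤ N` (`circuitRHS_eq_zero_of_vanishing_below`),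
which is what makes the estimate linear in `W`. -/
theorem circuitRHS_abs_le {lam : ℝ} (hlam : 1 ≤ lam) {m : ℕ}
    (coeff : Fin m → Fin m → Fin m → Option (Fin 3) → ℝ) {K : ℝ} (hK0 : 0 ≤ K)
    (hK : ∀ i₁ i₂ i₃ μ, |coeff i₁ i₂ i₃ μ| ≤ K) (X : Fin m → ℤ → ℝ → ℝ) (t : ℝ) {N : ℕ} {n : ℤ}
    (hn0 : 0 ≤ n) (hnN : n ≤ N) {B W : ℝ} (hB0 : 0 ≤ B) (hW0 : 0 ≤ W)
    (hB : ∀ (i : Fin m) (n' : ℤ), n' ≤ N + 1 → |X i n' t| ≤ B)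
    (hW : ∀ (i : Fin m) (n' : ℤ), n' ≤ N → |X i n' t| ≤ W) (i : Fin m) :
    |circuitRHS lam coeff X i n t| ≤ lam ^ (N : ℝ) * (1 + 4 * (m : ℝ) ^ 2 * K * B) * W := by
  have hlampos : 0 < lam := by linarith
  have hpowN : ∀ e : ℝ, e ≤ N → lam ^ e ≤ lam ^ (N : ℝ) := fun e he =>
    Real.rpow_le_rpow_of_exponent_le hlam he
  have hlamN0 : 0 ≤ lam ^ (N : ℝ) := (Real.rpow_pos_of_pos hlampos _).le
  have hnR : (n : ℝ) ≤ N := by exact_mod_cast hnN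
  have hn0R : (0 : ℝ) ≤ n := by exact_mod_cast hn0
  -- linear part
  have hlin : |-(lam ^ ((4 / 5 : ℝ) * n)) * X i n t| ≤ lam ^ (N : ℝ) * W := by
    rw [abs_mul, abs_neg, abs_of_nonneg (Real.rpow_pos_of_pos hlampos _).le]
    exact mul_le_mul (hpowN _ (by nlinarith)) (hW i n hnN) (abs_nonneg _) hlamN0
  -- generic four-factor bound
  have key : ∀ (a b c d A C D : ℝ), |a| ≤ A → b ≤ lam ^ (N : ℝ) → |c| ≤ C → |d| ≤ D → 0 ≤ b →
      0 ≤ A → 0 ≤ C → |a| * b * |c| * |d| ≤ A * lam ^ (N : ℝ) * C * D := by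
    intro a b c d A C D ha hb hc hd hb0 hA0 hC0
    have h1 : |a| * b ≤ A * lam ^ (N : ℝ) := mul_le_mul ha hb hb0 hA0
    have h2 : |a| * b * |c| ≤ A * lam ^ (N : ℝ) * C :=
      mul_le_mul h1 hc (abs_nonneg _) (mul_nonneg hA0 hlamN0)
    exact mul_le_mul h2 hd (abs_nonneg _) (mul_nonneg (mul_nonneg hA0 hlamN0) hC0)
  -- quadratic part, termwise
  have hterm : ∀ (i₁ i₂ : Fin m) (μ : Option (Fin 3)),
      |coeff i₁ i₂ i μ * lam ^ ((n : ℝ) - (if μ = some 2 then 1 else 0)) *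
        X i₁ (n + ((if μ = some 0 then 1 else 0) - (if μ = some 2 then 1 else 0))) t *
        X i₂ (n + ((if μ = some 1 then 1 else 0) - (if μ = some 2 then 1 else 0))) t|
        ≤ K * lam ^ (N : ℝ) * B * W := by
    intro i₁ i₂ μ
    rw [abs_mul, abs_mul, abs_mul, abs_of_nonneg (Real.rpow_pos_of_pos hlampos _).le]
    have hc := hK i₁ i₂ i μ
    rcases μ with _ | a
    · simp only [reduceCtorEq, ite_false, sub_zero, add_zero]
      exact key _ _ _ _ _ _ _ hc (hpowN _ hnR) (hB i₁ n (by linarith)) (hW i₂ n hnN)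
        (Real.rpow_pos_of_pos hlampos _).le hK0 hB0
    · fin_cases a
      · simp only [Fin.zero_eta, Fin.isValue, Option.some.injEq, Fin.reduceEq, ite_false,
          sub_zero, ite_true, add_zero]
        exact key _ _ _ _ _ _ _ hc (hpowN _ hnR) (hB i₁ (n + 1) (by linarith)) (hW i₂ n hnN)
          (Real.rpow_pos_of_pos hlampos _).le hK0 hB0
      · simp only [Fin.mk_one, Fin.isValue, Option.some.injEq, Fin.reduceEq, ite_false,
          sub_zero, add_zero, ite_true]
        calc |coeff i₁ i₂ i (some 1)| * lam ^ (n : ℝ) * |X i₁ n t| * |X i₂ (n + 1) t|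
            ≤ K * lam ^ (N : ℝ) * W * B :=
              key _ _ _ _ _ _ _ hc (hpowN _ hnR) (hW i₁ n hnN) (hB i₂ (n + 1) (by linarith))
                (Real.rpow_pos_of_pos hlampos _).le hK0 hW0
          _ = K * lam ^ (N : ℝ) * B * W := by ring
      · simp only [Fin.reduceFinMk, Fin.isValue, ite_true, Option.some.injEq, Fin.reduceEq,
          ite_false, zero_sub]
        have h1 : (n : ℝ) - 1 ≤ N := by linarith
        exact key _ _ _ _ _ _ _ hc (hpowN _ h1) (hB i₁ (n + -1) (by linarith))
          (hW i₂ (n + -1) (by linarith)) (Real.rpow_pos_of_pos hlampos _).le hK0 hB0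
  have hquad : |∑ i₁ : Fin m, ∑ i₂ : Fin m, ∑ μ : Option (Fin 3),
      coeff i₁ i₂ i μ * lam ^ ((n : ℝ) - (if μ = some 2 then 1 else 0)) *
        X i₁ (n + ((if μ = some 0 then 1 else 0) - (if μ = some 2 then 1 else 0))) t *
        X i₂ (n + ((if μ = some 1 then 1 else 0) - (if μ = some 2 then 1 else 0))) t|
        ≤ 4 * (m : ℝ) ^ 2 * K * lam ^ (N : ℝ) * B * W := by
    refine (Finset.abs_sum_le_sum_abs _ _).trans ?_
    refine (Finset.sum_le_sum fun i₁ _ => Finset.abs_sum_le_sum_abs _ _).trans ?_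
    refine (Finset.sum_le_sum fun i₁ _ => Finset.sum_le_sum fun i₂ _ =>
      Finset.abs_sum_le_sum_abs _ _).trans ?_
    refine (Finset.sum_le_sum fun i₁ _ => Finset.sum_le_sum fun i₂ _ =>
      Finset.sum_le_sum fun μ _ => hterm i₁ i₂ μ).trans ?_
    simp only [Finset.sum_const, Finset.card_univ, Fintype.card_option, Fintype.card_fin,
      nsmul_eq_mul]
    push_cast
    nlinarith [sq_nonneg (m : ℝ)]
  unfold circuitRHS
  refine (abs_add_le _ _).trans ?_
  have : lam ^ (N : ℝ) * W + 4 * (m : ℝ) ^ 2 * K * lam ^ (N : ℝ) * B * W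
      = lam ^ (N : ℝ) * (1 + 4 * (m : ℝ) ^ 2 * K * B) * W := by ring
  linarith

/-- **BACKWARD UNIQUENESS / GRÖNWALL FOR THE LOW BLOCK** (the formal kernel of the planner's
flagged gap "backward uniqueness of the chain at blow-up"). For a solution of the circuit on
`[t₀, t₁]` with no modes below scale `0` and amplitudes `≤ B` on the scales `≤ N+1`, the block
`(X_{i,n})_{0 ≤ n ≤ N}` obeys `|X_{i,n}(t)| ≤ δ · exp(L (t₁ - t))` whenever it is `≤ δ` at the
LATER time `t₁`, with `L = lam^N (1 + 4 m² K B)`. In particular (δ = 0) the block cannot be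
emptied in finite time unless it was always empty: a front cannot pass tracelessly. The rates of
the low block are bounded (`≤ lam^N`), so no fine structure is needed — only one-sided coupling
(`circuitRHS_abs_le`). For the recentred two-sided limit objects of the `CircuitTrace` argument,
provers need the same estimate with geometric weights `θ^{N-n}` on an infinite block `n ≤ N`
(same proof, `L ↦ L(1 + θ⁻¹)`), or — cheaper — apply THIS lemma to the recentred solutions before
passing to the limit. -/
theorem block_backward_gronwall {lam : ℝ} (hlam : 1 ≤ lam) {m : ℕ}
    (coeff : Fin m → Fin m → Fin m → Option (Fin 3) → ℝ) {K : ℝ} (hK0 : 0 ≤ K)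
    (hK : ∀ i₁ i₂ i₃ μ, |coeff i₁ i₂ i₃ μ| ≤ K) (X : Fin m → ℤ → ℝ → ℝ) {t₀ t₁ : ℝ}
    (N : ℕ)
    (hderiv : ∀ (i : Fin m) (n : ℤ), ∀ t ∈ Set.Icc t₀ t₁,
      HasDerivAt (X i n) (circuitRHS lam coeff X i n t) t)
    (hcut : ∀ (i : Fin m) (n : ℤ) (t : ℝ), n < 0 → X i n t = 0)
    {B : ℝ} (hB0 : 0 ≤ B)
    (hB : ∀ (i : Fin m) (n : ℤ), n ≤ N + 1 → ∀ t ∈ Set.Icc t₀ t₁, |X i n t| ≤ B)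
    {δ : ℝ} (hδ0 : 0 ≤ δ) (hδ : ∀ (i : Fin m) (n : ℤ), 0 ≤ n → n ≤ N → |X i n t₁| ≤ δ) :
    ∀ (i : Fin m) (n : ℤ), 0 ≤ n → n ≤ N → ∀ t ∈ Set.Icc t₀ t₁,
      |X i n t| ≤ δ * Real.exp (lam ^ (N : ℝ) * (1 + 4 * (m : ℝ) ^ 2 * K * B) * (t₁ - t)) := by
  set L := lam ^ (N : ℝ) * (1 + 4 * (m : ℝ) ^ 2 * K * B) with hL
  have hlampos : 0 < lam := by linarith
  have hL0 : 0 ≤ L := by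
    have : 0 ≤ lam ^ (N : ℝ) := (Real.rpow_pos_of_pos hlampos _).le
    have : 0 ≤ 4 * (m : ℝ) ^ 2 * K * B := by positivity
    rw [hL]; nlinarith
  -- the block as a curve in the sup-normed space `Fin m × Fin (N+1) → ℝ`
  set w : ℝ → (Fin m × Fin (N + 1) → ℝ) := fun t p => X p.1 ((p.2 : ℕ) : ℤ) t with hw
  set w' : ℝ → (Fin m × Fin (N + 1) → ℝ) :=
    fun t p => circuitRHS lam coeff X p.1 ((p.2 : ℕ) : ℤ) t with hw'
  have hwd : ∀ t ∈ Set.Icc t₀ t₁, HasDerivAt w (w' t) t := fun t ht =>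
    hasDerivAt_pi.2 fun p => hderiv p.1 _ t ht
  have hcomp : ∀ (t : ℝ) (i : Fin m) (n : ℤ), 0 ≤ n → n ≤ N → |X i n t| ≤ ‖w t‖ := by
    intro t i n h0 hN
    obtain ⟨k, rfl⟩ := Int.eq_ofNat_of_zero_le h0
    have hk : k < N + 1 := by omega
    have := norm_le_pi_norm (w t) (i, ⟨k, hk⟩)
    simpa [hw, Real.norm_eq_abs] using this
  have hlow : ∀ (t : ℝ) (i : Fin m) (n : ℤ), n ≤ N → |X i n t| ≤ ‖w t‖ := by
    intro t i n hN
    by_cases h0 : 0 ≤ n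
    · exact hcomp t i n h0 hN
    · rw [hcut i n t (not_le.mp h0), abs_zero]; exact norm_nonneg _
  have hp2 : ∀ p : Fin m × Fin (N + 1), (((p.2 : ℕ) : ℤ)) ≤ N := fun p => by
    exact_mod_cast Nat.lt_succ_iff.mp p.2.isLt
  -- reversed time
  set g : ℝ → (Fin m × Fin (N + 1) → ℝ) := fun s => w (t₁ - s) with hg
  set g' : ℝ → (Fin m × Fin (N + 1) → ℝ) := fun s => -(w' (t₁ - s)) with hg'
  have hgd : ∀ s ∈ Set.Icc 0 (t₁ - t₀), HasDerivAt g (g' s) s := by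
    intro s hs
    have h1 : HasDerivAt (fun s : ℝ => t₁ - s) (-1) s := by
      simpa using (hasDerivAt_id s).const_sub t₁
    have hmem : t₁ - s ∈ Set.Icc t₀ t₁ := ⟨by linarith [hs.2], by linarith [hs.1]⟩
    have h2 := (hwd (t₁ - s) hmem).scomp s h1
    have h3 : g' s = (-1 : ℝ) • w' (t₁ - s) := by rw [hg', neg_one_smul]
    rw [h3]
    exact h2
  have hbound : ∀ s ∈ Set.Ico 0 (t₁ - t₀), ‖g' s‖ ≤ L * ‖g s‖ + 0 := by
    intro s hs
    rw [add_zero, hg', norm_neg]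
    have hmem : t₁ - s ∈ Set.Icc t₀ t₁ := ⟨by linarith [hs.2], by linarith [hs.1]⟩
    refine (pi_norm_le_iff_of_nonneg (mul_nonneg hL0 (norm_nonneg _))).2 fun p => ?_
    rw [Real.norm_eq_abs]
    exact circuitRHS_abs_le hlam coeff hK0 hK X (t₁ - s) (Int.natCast_nonneg _) (hp2 p) hB0
      (norm_nonneg _) (fun i n' hn' => hB i n' hn' _ hmem) (fun i n' hn' => hlow _ i n' hn') p.1
  have hg0 : ‖g 0‖ ≤ δ := by
    refine (pi_norm_le_iff_of_nonneg hδ0).2 fun p => ?_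
    rw [Real.norm_eq_abs]
    simpa [hg, hw] using hδ p.1 _ (Int.natCast_nonneg _) (hp2 p)
  have hG := norm_le_gronwallBound_of_norm_deriv_right_le (f := g) (f' := g') (δ := δ) (K := L)
    (ε := 0) (a := 0) (b := t₁ - t₀)
    (fun s hs => (hgd s hs).continuousAt.continuousWithinAt)
    (fun s hs => (hgd s (Set.Ico_subset_Icc_self hs)).hasDerivWithinAt) hg0 hbound
  intro i n h0 hN t ht
  have hs : t₁ - t ∈ Set.Icc 0 (t₁ - t₀) := ⟨by linarith [ht.2], by linarith [ht.1]⟩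
  have := hG (t₁ - t) hs
  rw [gronwallBound_ε0, sub_zero] at this
  calc |X i n t| ≤ ‖w t‖ := hcomp t i n h0 hN
    _ = ‖g (t₁ - t)‖ := by simp [hg]
    _ ≤ δ * Real.exp (L * (t₁ - t)) := this

/-- The structure constants are finitely many: a common bound. -/
theorem exists_coeff_bound {m : ℕ} (coeff : Fin m → Fin m → Fin m → Option (Fin 3) → ℝ) :
    ∃ K : ℝ, 0 ≤ K ∧ ∀ i₁ i₂ i₃ μ, |coeff i₁ i₂ i₃ μ| ≤ K := by
  obtain ⟨M, hM⟩ := Finite.exists_le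
    (fun q : Fin m × Fin m × Fin m × Option (Fin 3) => |coeff q.1 q.2.1 q.2.2.1 q.2.2.2|)
  exact ⟨max M 0, le_max_right _ _, fun i₁ i₂ i₃ μ => (hM (i₁, i₂, i₃, μ)).trans (le_max_left _ _)⟩

/-- Corollary (exact backward uniqueness into the invariant subspace `{X_{≤ N} = 0}`): if the low
block is empty at time `t₁` it was empty on all of `[t₀, t₁]`. -/
theorem block_eq_zero_backward {lam : ℝ} (hlam : 1 ≤ lam) {m : ℕ}
    (coeff : Fin m → Fin m → Fin m → Option (Fin 3) → ℝ) (X : Fin m → ℤ → ℝ → ℝ) {t₀ t₁ : ℝ}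
    (N : ℕ)
    (hderiv : ∀ (i : Fin m) (n : ℤ), ∀ t ∈ Set.Icc t₀ t₁,
      HasDerivAt (X i n) (circuitRHS lam coeff X i n t) t)
    (hcut : ∀ (i : Fin m) (n : ℤ) (t : ℝ), n < 0 → X i n t = 0)
    {B : ℝ} (hB0 : 0 ≤ B)
    (hB : ∀ (i : Fin m) (n : ℤ), n ≤ N + 1 → ∀ t ∈ Set.Icc t₀ t₁, |X i n t| ≤ B)
    (hzero : ∀ (i : Fin m) (n : ℤ), 0 ≤ n → n ≤ N → X i n t₁ = 0) :
    ∀ (i : Fin m) (n : ℤ), n ≤ N → ∀ t ∈ Set.Icc t₀ t₁, X i n t = 0 := by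
  obtain ⟨K, hK0, hK⟩ := exists_coeff_bound coeff
  intro i n hN t ht
  by_cases h0 : 0 ≤ n
  · have h := block_backward_gronwall hlam coeff hK0 hK X N hderiv hcut hB0 hB le_rfl
      (fun i n h0 hN => by rw [hzero i n h0 hN, abs_zero]) i n h0 hN t ht
    rw [zero_mul] at h
    exact abs_eq_zero.mp (le_antisymm h (abs_nonneg _))
  · exact hcut i n t (not_le.mp h0)

end Summit.NavierStokesRegularity.NavierStokesRegularity.Theorems.CircuitTrace.Negative
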